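/-
Copyright (c) 2026 the pub-hodgecm-mathlib formalisation cell (harness21).  Prover seat hodgecm-mathlib-K2Liu-p02 (g9), Track B «K2-LIT» ∕ hLiu418
#184♮, Road I v3, unit U5 «THE CLOSE», FACE-D₀ row `h2₂`, brick (B1c′-1) FILE 3 «the κ-model of the LINE PAIR on pure tensors»
(LEAD F0P6-plan (g15) BATCH #181 (5) ∕ #183 (1), tie desk typ3 fit notes 00:26:26Z, 2026-09-05).  THEOREMS ONLY.
-/
import Summits.HodgeConjecture.HodgeConjecture.Theorems.K2LiuMetaplecticUnipotentRigidity    -- ★ p863642 FILE 1: `eq_on_unipDelta_of_proj_eq` (+ ★ `adelicSiegelLiftConj` API)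
import Summits.HodgeConjecture.HodgeConjecture.Theorems.K2LiuFinChirpTensorSlot              -- ★ p863400 (B1c′-3): `chirpLM_tmul_of_archPart_eq_zero` (+ ★ `finMulLM`, `finSdChar`)
import Literature.NumberTheory.K2Lit.DoubledLineThetaKernel                                 -- ★ D8: `dD`, `toDiagA`, the line pair `pairRep … (chiSplittingLine …)`
import HarnessLib

/-!
# K2_Liu road (hLiu418 = stmt-HodgeConjecture-24832), FACE-D₀ row `h2₂`, brick (B1c′-1) FILE 3: THE κ-MODEL ON PURE TENSORS —
# in the model `Tg := M_q⁻¹` a Siegel unipotent of the doubled group acts on `Φ_∞ ⊗ φ` by a chirp MULTIPLIER in the finite slot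

Cell `pub/hodgecm-mathlib` (D-0151), Track B, build stream 29; helper lane `--supports stmt-HodgeConjecture-24832 --as helper`, count-neutral.

This file turns ★ p863642 `K2LiuMetaplecticUnipotentRigidity` (any homomorphism `s : H(𝔸) →* Mp_ψ(𝕎_𝔸)ᶜᵒⁿᵗ` agrees on `N_Δ(𝔸)` with
Weil's transported canonical lift `x ↦ q · 𝐫₀(g⁻¹ π(s x) g) · q⁻¹`) into the SHAPE of the one letter `hκ` of ★ p863332
`K2LiuFirstTermLineLiftRankRowModelConj.h2Row_thetaSide_of_finLineModel_conj` (:209–:217).  Everything specific to the Cayley mover is taken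
BY VALUE as READINGS of the conjugated symplectic element `p_u := g⁻¹ π(s u) g ∈ P_𝕐(𝔸)` — its Levi block `a_{p_u}⁻¹ = 1` and its chirp
parameter `S_u := −½ c_{p_u}` with vanishing archimedean part — so that FILE 2 `K2LiuLinePairCayleySiegel` (F0P2-p10 (g3): the line Cayley
mover `κ′`, membership `hj`, the unipotent block) and K2E3-p23 (g8)'s S-letters PAY this file's letters with no import coupling.

* §1 (generic: any number field `F`, rank `m`, Gram unit `T`, any `s : H(𝔸) →* Mp_ψ(𝕎_𝔸)ᶜᵒⁿᵗ`, any `g ∈ Sp(𝕎_𝔸)` with lift `q`)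
  `toOp_adelicSiegelLift_eq_chirpLM` — `a_p⁻¹ = 1 ⇒ M_{𝐫₀ p} = t(−½ c_p)` (★ `coe_toOp_adelicSiegelLift`);
  **`kappaModel_tmul_of_mem_unipDelta`** — for `u ∈ N_Δ(𝔸)` with readings `a⁻¹ = 1`, `−½ c = S`, `S_∞ = 0`:
  `M_q⁻¹ (ω(s u) (M_q (Φ_∞ ⊗ φ))) = Φ_∞ ⊗ (ψ_f(q_{S_f}) · φ)` (★ p863642 §4 + ★ p863400).
* §2 (the LINE PAIR of ★ D8: `H = U(𝔻)`, `W = ⟨a′⟩`, `s_line := pairSplitting (chiSplittingLine λ⁻¹ …) ∘ (toDiagA ·, 1)`, Gram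
  `T₁ = adelicGram e₁ (realDiagonal dD) (T_W a′)`) `proj_pairSplitting_line` (`π(s_line(x, 1)) = ι(x ⊗ 1)`);
  **`pairRep_line_kappaModel_tmul`** — the same identity for `ω = pairRep … (chiSplittingLine …)` at the pair point `(toDiagA u, 1)`, with the
  membership letter `hj` in FILE 2's currency `g⁻¹ · toSp … (adelicInl (toDiagA p)) · g ∈ P_𝕐(T₁)` (`p ∈ P_Δ(𝔸)`).
* the `hκ` SHAPE of ★ p863332 (`∃ Tg, ∀ z Φ_∞ φ, …` over an index map `ι : Z → N_Δ(𝔸)` and a finite-slot representation `ρf` with its eq-letter) is the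
  sequel file `K2LiuLinePairKappaModelLetter` (400-line cap).

No definition, no instance, no notation, no named-fact hypothesis, no `sorry`; axioms ⊆ {propext, Classical.choice, Quot.sound}.  HONEST LABEL: HC_CM is proved
only modulo the 7 printed citations (2 remaining named inputs: hLiu418 = stmt-HodgeConjecture-24832, h413 = stmt-HodgeConjecture-24833) until rung 0 closes; this file
moves no counter: `h2₂` needs FILE 2's `hj` + readings at the line datum and K2E3-p23's S-letters (`hρf`, `hι∞`, `hρm`, `hχ`, `hχS`, …) in the tie.

References: [Weil1964] A. Weil, Acta Math. 111 (1964), Chap. I n° 13 p. 160 (`𝐫₀ = t₀ d₀`), n° 34 p. 184 (`t(f)`), Chap. III n° 36–38 pp. 187–190;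
[Kudla1994] S. S. Kudla, Israel J. Math. 87 (1994), §3; [Kudla1996] S. S. Kudla, *Notes on the local theta correspondence*, Chap. I §2 Prop. 2.3;
[MoeglinVignerasWaldspurger1987] LNM 1291, Chap. 2 II.1 (B), II.2; [GelbartRogawski1991] §3.1 Prop. 3.1.1 p. 455; [Liu2021] App. B Prop. B.8 p. 104,
App. D §D.1 Step 2.
-/

set_option autoImplicit false
set_option linter.dupNamespace false
-- the line-pair carriers elaborate to very large types; elaborate sequentially (as in ★ `K2LiuFirstTermLineLiftRankRowModelConj`)
set_option Elab.async false

noncomputable section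

open NumberField NumberField.mixedEmbedding IsDedekindDomain
open scoped Matrix TensorProduct SchwartzMap Classical  -- `Classical`: the `Fintype` of real ∕ complex places inside `mixedSpace` (as ★ p863332, ★ p863400)

namespace Summit.HodgeConjecture.HodgeConjecture.Cruxes.HLiu418.K2LiuLinePairKappaModelOnUnipotents

open Literature.NumberTheory.Automorphic Literature.NumberTheory.Automorphic.UnitaryGroup Literature.NumberTheory.GaloisRepresentations
open Literature.NumberTheory.Automorphic.IdeleClassGroup
open Literature.NumberTheory.Automorphic.Liu2021 Literature.NumberTheory.Automorphic.Liu2021.Def411WeilCarriers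
open Literature.NumberTheory.Automorphic.Liu2021.Def411WeilCarriersDoubling
open Literature.RepresentationTheory.HeisenbergGroup Literature.RepresentationTheory.Liu2021
open Literature.NumberTheory.GelbartRogawski1991 Literature.NumberTheory.GelbartRogawski1991.UnitaryDualPair
open Literature.NumberTheory.GelbartRogawski1991.GRConstruction
open Literature.NumberTheory.K2Lit.SiegelDoubled Literature.NumberTheory.K2Lit.DoubledLineTheta
open Literature.NumberTheory.Weil1964
open Summit.HodgeConjecture.HodgeConjecture.Cruxes.HLiu418.K2LiuMetaplecticUnipotentRigidity (eq_on_unipDelta_of_proj_eq omega_eq_conj_siegelLift_of_mem_unipDelta)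
open Summit.HodgeConjecture.HodgeConjecture.Cruxes.HLiu418.K2LiuFinChirpTensorSlot (chirpLM_tmul_of_archPart_eq_zero)

variable (L : Type) [Field L] [NumberField L] [IsCMField L]
variable {N M n : ℕ} (e : Fin N × Fin M ≃ Fin n)
  (dV : Fin N → L) (hdV : ∀ i, IsCMField.complexConj L (dV i) = dV i)
  (dW : Fin M → L) (hdW : ∀ i, IsCMField.complexConj L (dW i) = dW i)

/-! ## §1 Generic: the κ-model of ANY homomorphism `s : H(𝔸) →* Mp_ψ(𝕎_𝔸)ᶜᵒⁿᵗ` on a pure tensor, from the Siegel readings -/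

section Generic

variable {F : Type} [Field F] [NumberField F] {m : ℕ} {TA : Matrix (Fin m) (Fin m) (AdeleRing (𝓞 F) F)}

/-- **`a_p⁻¹ = 1 ⇒ M_{𝐫₀ p} = t(−½ c_p)`**: Weil's canonical lift of a Siegel-parabolic element with trivial Levi block is the chirp operator of its
symmetric parameter (★ `coe_toOp_adelicSiegelLift`: `(M_{𝐫₀ p} Φ)(x) = ψ_F(q_{−½ c_p}(a_p⁻¹ x)) Φ(a_p⁻¹ x)`).
[cite: Weil1964, Chap. I n° 13 p. 160] [cite: Kudla1996, Chap. I §2 Prop. 2.3] -/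
theorem toOp_adelicSiegelLift_eq_chirpLM (hT : IsUnit TA.det) (p : siegelParabolicPi TA)
    (ha : SiegelParabolicPi.aInvMat (p : symplecticGroup (polar (adelicForm F (Fin m) TA))) = 1) (Φ : piSchwartzBruhat F (Fin m)) :
    MpPsi.toOp (adelicSchrodinger F (Fin m) TA) (adelicSiegelLift F TA hT p) Φ =
      chirpLM F ((-⅟(2 : AdeleRing (𝓞 F) F)) • SiegelParabolicPi.cMat (p : symplecticGroup (polar (adelicForm F (Fin m) TA)))) Φ := by
  apply Subtype.ext
  funext x
  rw [coe_toOp_adelicSiegelLift, ha, Matrix.one_mulVec, coe_chirpLM, chirp_apply]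

/-- **THE κ-MODEL ON A PURE TENSOR, GENERIC.**  Let `s : H(𝔸) →* Mp_ψ(𝕎_𝔸)ᶜᵒⁿᵗ` be ANY homomorphism whose symplectic image of `P_Δ(𝔸)` lies in
`g P_𝕐(𝔸) g⁻¹`, `q` a lift of `g`, and `u ∈ N_Δ(𝔸)` with READINGS of `p_u := g⁻¹ π(s u) g`: Levi block `a_{p_u}⁻¹ = 1`, chirp parameter `−½ c_{p_u} = S` with
`S_∞ = 0`.  Then in the model `Tg := M_q⁻¹` the operator `ω(s u)` maps `Φ_∞ ⊗ φ` to `Φ_∞ ⊗ (ψ_f(q_{S_f}) · φ)` — ★ p863642 `omega_eq_conj_siegelLift_of_mem_unipDelta`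
(`ω(s u) = M_q M_{𝐫₀ p_u} M_q⁻¹`, scalar-exact), `toOp_adelicSiegelLift_eq_chirpLM`, ★ p863400 `chirpLM_tmul_of_archPart_eq_zero`.
[cite: Weil1964, Chap. I n° 13 p. 160, n° 34 p. 184] [cite: Kudla1994, §3] [cite: MoeglinVignerasWaldspurger1987, Chap. 2 II.1 (B)] -/
theorem kappaModel_tmul_of_mem_unipDelta (hdV0 : ∀ i, dV i ≠ 0) (hdW0 : ∀ i, dW i ≠ 0) (hT : IsUnit TA.det)
    (s : HA L e dV hdV dW hdW →* adelicMpCont F (Fin m) TA) (g : symplecticGroup (polar (adelicForm F (Fin m) TA)))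
    (q : adelicMp F (Fin m) TA) (hqc : q ∈ adelicMpCont F (Fin m) TA) (hq : MpPsi.proj _ q = g)
    (hj : ∀ p : ↥(siegelDelta L e dV hdV dW hdW),
      g⁻¹ * ((adelicMpCont.proj F (Fin m) TA).comp (s.comp (siegelDelta L e dV hdV dW hdW).subtype)) p * g ∈ siegelParabolicPi TA)
    {u : HA L e dV hdV dW hdW} (hu : u ∈ unipDelta L e dV hdV dW hdW)
    (ha : SiegelParabolicPi.aInvMat (g⁻¹ * adelicMpCont.proj F (Fin m) TA (s u) * g) = 1)
    {S : Matrix (Fin m) (Fin m) (AdeleRing (𝓞 F) F)}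
    (hS : (-⅟(2 : AdeleRing (𝓞 F) F)) • SiegelParabolicPi.cMat (g⁻¹ * adelicMpCont.proj F (Fin m) TA (s u) * g) = S)
    (hS0 : S.map (archHom F) = 0) (Φinf : 𝓢((Fin m → mixedSpace F), ℂ)) (φ : FinSB F (Fin m)) :
    (MpPsi.toOp (adelicSchrodinger F (Fin m) TA) q).symm
        (adelicMpCont.omega F (Fin m) TA (s u)
          (MpPsi.toOp (adelicSchrodinger F (Fin m) TA) q (piSchwartzBruhatEquiv F (Fin m) (Φinf ⊗ₜ[ℂ] φ)))) =
      piSchwartzBruhatEquiv F (Fin m) (Φinf ⊗ₜ[ℂ]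
        finMulLM (finSdChar (S.map (RingHom.snd (InfiniteAdeleRing F) (FiniteAdeleRing (𝓞 F) F)))) (isLocallyConstant_finSdChar _) φ) := by
  have h1 := omega_eq_conj_siegelLift_of_mem_unipDelta L e dV hdV dW hdW hdV0 hdW0 hT s g q hqc hq hj hu
    (MpPsi.toOp (adelicSchrodinger F (Fin m) TA) q (piSchwartzBruhatEquiv F (Fin m) (Φinf ⊗ₜ[ℂ] φ)))
  have h2 : (MpPsi.toOp (adelicSchrodinger F (Fin m) TA) q)⁻¹
      (MpPsi.toOp (adelicSchrodinger F (Fin m) TA) q (piSchwartzBruhatEquiv F (Fin m) (Φinf ⊗ₜ[ℂ] φ))) =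
        piSchwartzBruhatEquiv F (Fin m) (Φinf ⊗ₜ[ℂ] φ) :=
    (MpPsi.toOp (adelicSchrodinger F (Fin m) TA) q).symm_apply_apply _
  have h3 := toOp_adelicSiegelLift_eq_chirpLM hT
    ⟨g⁻¹ * adelicMpCont.proj F (Fin m) TA (s u) * g, hj ⟨u, unipDelta_le_siegelDelta L e dV hdV dW hdW hu⟩⟩ ha
    (piSchwartzBruhatEquiv F (Fin m) (Φinf ⊗ₜ[ℂ] φ))
  exact (congrArg (MpPsi.toOp (adelicSchrodinger F (Fin m) TA) q).symm h1).trans <|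
    ((MpPsi.toOp (adelicSchrodinger F (Fin m) TA) q).symm_apply_apply _).trans <|
      (congrArg (MpPsi.toOp (adelicSchrodinger F (Fin m) TA) (adelicSiegelLift F TA hT
        ⟨g⁻¹ * adelicMpCont.proj F (Fin m) TA (s u) * g, hj ⟨u, unipDelta_le_siegelDelta L e dV hdV dW hdW hu⟩⟩)) h2).trans <|
        h3.trans <| (congrArg (fun S' => chirpLM F S' (piSchwartzBruhatEquiv F (Fin m) (Φinf ⊗ₜ[ℂ] φ))) hS).trans
          (chirpLM_tmul_of_archPart_eq_zero F S hS0 Φinf φ)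

end Generic

/-! ## §2 The LINE PAIR `(U(𝔻), U(⟨a′⟩))` of ★ D8: the κ-model of `pairRep … (chiSplittingLine …)` at `(toDiagA u, 1)` -/

section Line

variable {n'' : ℕ} (e₁ : Fin (n + n) × Fin 1 ≃ Fin n'') (hdV0 : ∀ i, dV i ≠ 0) (hdW0 : ∀ i, dW i ≠ 0)
  (lam : IdeleClassGroup L →ₜ* Circle) (hlam : IsConjugateSymplectic L lam) (a' : (Fp L)ˣ)

/-- **`π(s_line(x, 1)) = ι(x ⊗ 1)`**: the projection of the line pair's splitting `pairSplitting (chiSplittingLine …)` at a point `(x, 1)` is the symplectic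
realisation `toSp … (adelicInl x)` (★ `proj_pairSplitting` for the compatible ★ `chiSplittingLine`, `s(1 ⊗ 1) = 1`).
[cite: GelbartRogawski1991, §3.1 Prop. 3.1.1 p. 455 L1–3] [cite: Liu2021, App. D §D.1 Step 2] -/
theorem proj_pairSplitting_line (x : ↥(UnitaryGroup.adelic (Fp L) L (IsCMField.complexConj L) (n + n) (Matrix.diagonal (dD L e dV hdV dW hdW)))) :
    adelicMpCont.proj (Fp L) (Fin n'') (adelicGram (Fp L) e₁ (realDiagonal L (dD L e dV hdV dW hdW) (dD_conj L e dV hdV dW hdW)) (TW (Fp L) a'))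
        (pairSplitting (Fp L) L (IsCMField.complexConj L) (n + n) 1 e₁ (Matrix.diagonal (dD L e dV hdV dW hdW)) (JW (Fp L) L a')
          (chiSplittingLine L e₁ (dD L e dV hdV dW hdW) (dD_conj L e dV hdV dW hdW) (dD_ne_zero L e dV hdV dW hdW hdV0 hdW0)
            (toHeckeCharacter L lam) (isUnitary_toHeckeCharacter L lam)
            ((isOscillatorChar_toHeckeCharacter_iff lam).mpr hlam) (TW (Fp L) a')
            (isUnit_det_TW (Fp L) a') (JW (Fp L) L a') (JW_eq (Fp L) L a')) (x, 1)) =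
      toSp (Fp L) L (IsCMField.complexConj L) (n + n) 1 e₁ (Matrix.diagonal (dD L e dV hdV dW hdW)) (JW (Fp L) L a')
        (complexConj_imagUnit L) (imagUnit_ne_zero L) (imagUnit_mul_self L)
        (realDiagonal_isSymm L (dD L e dV hdV dW hdW) (dD_conj L e dV hdV dW hdW)) (isSymm_TW (Fp L) a')
        (realDiagonal_map L (dD L e dV hdV dW hdW) (dD_conj L e dV hdV dW hdW)).symm (JW_eq (Fp L) L a')
        (UnitaryGroup.adelicInl (Fp L) L (IsCMField.complexConj L) (n + n) 1 (Matrix.diagonal (dD L e dV hdV dW hdW)) (JW (Fp L) L a') x) := by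
  rw [proj_pairSplitting (Fp L) L (IsCMField.complexConj L) (n + n) 1 e₁ (Matrix.diagonal (dD L e dV hdV dW hdW)) (JW (Fp L) L a')
    (complexConj_imagUnit L) (imagUnit_ne_zero L) (imagUnit_mul_self L)
    (realDiagonal_isSymm L (dD L e dV hdV dW hdW) (dD_conj L e dV hdV dW hdW)) (isSymm_TW (Fp L) a')
    (isUnit_det_realDiagonal L (dD L e dV hdV dW hdW) (dD_conj L e dV hdV dW hdW) (dD_ne_zero L e dV hdV dW hdW hdV0 hdW0))
    (isUnit_det_TW (Fp L) a') (realDiagonal_map L (dD L e dV hdV dW hdW) (dD_conj L e dV hdV dW hdW)).symm (JW_eq (Fp L) L a')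
    (isCompatible_chiSplittingLine L e₁ (dD L e dV hdV dW hdW) (dD_conj L e dV hdV dW hdW) (dD_ne_zero L e dV hdV dW hdW hdV0 hdW0)
      (toHeckeCharacter L lam) (isUnitary_toHeckeCharacter L lam) ((isOscillatorChar_toHeckeCharacter_iff lam).mpr hlam)
      (TW (Fp L) a') (isSymm_TW (Fp L) a') (isUnit_det_TW (Fp L) a') (JW (Fp L) L a') (JW_eq (Fp L) L a')) (x, 1),
    map_one, mul_one]

set_option maxHeartbeats 1000000 in -- the statement over the line-pair carriers times out at the default (measured), as ★ p863332
/-- **THE κ-MODEL OF THE LINE PAIR ON A PURE TENSOR.**  For the Weil representation `pairRep … (chiSplittingLine λ⁻¹ at T_W = a′)` of `(U(𝔻), U(⟨a′⟩))` (★ D8),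
any `g ∈ Sp(𝕎_𝔸)` conjugating the symplectic image of `P_Δ(𝔸) × 1` into `P_𝕐(𝔸)` (`hj`, FILE 2's currency), a lift `q` of `g`, and `u ∈ N_Δ(𝔸)` with the
readings `a⁻¹ = 1`, `−½ c = S`, `S_∞ = 0` of `g⁻¹ ι(u ⊗ 1) g`:  `M_q⁻¹ (ω(toDiagA u, 1) (M_q (Φ_∞ ⊗ φ))) = Φ_∞ ⊗ (ψ_f(q_{S_f}) · φ)`.
[cite: Weil1964, Chap. I n° 13 p. 160, n° 34 p. 184] [cite: Kudla1994, §3] [cite: Liu2021, App. B Prop. B.8 p. 104] -/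
theorem pairRep_line_kappaModel_tmul
    (g : symplecticGroup (polar (adelicForm (Fp L) (Fin n'')
      (adelicGram (Fp L) e₁ (realDiagonal L (dD L e dV hdV dW hdW) (dD_conj L e dV hdV dW hdW)) (TW (Fp L) a')))))
    (q : adelicMp (Fp L) (Fin n'') (adelicGram (Fp L) e₁ (realDiagonal L (dD L e dV hdV dW hdW) (dD_conj L e dV hdV dW hdW)) (TW (Fp L) a')))
    (hqc : q ∈ adelicMpCont (Fp L) (Fin n'') (adelicGram (Fp L) e₁ (realDiagonal L (dD L e dV hdV dW hdW) (dD_conj L e dV hdV dW hdW)) (TW (Fp L) a')))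
    (hq : MpPsi.proj _ q = g)
    (hj : ∀ p : ↥(siegelDelta L e dV hdV dW hdW),
      g⁻¹ * toSp (Fp L) L (IsCMField.complexConj L) (n + n) 1 e₁ (Matrix.diagonal (dD L e dV hdV dW hdW)) (JW (Fp L) L a')
          (complexConj_imagUnit L) (imagUnit_ne_zero L) (imagUnit_mul_self L)
          (realDiagonal_isSymm L (dD L e dV hdV dW hdW) (dD_conj L e dV hdV dW hdW)) (isSymm_TW (Fp L) a')
          (realDiagonal_map L (dD L e dV hdV dW hdW) (dD_conj L e dV hdV dW hdW)).symm (JW_eq (Fp L) L a')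
          (UnitaryGroup.adelicInl (Fp L) L (IsCMField.complexConj L) (n + n) 1 (Matrix.diagonal (dD L e dV hdV dW hdW)) (JW (Fp L) L a')
            (toDiagA L e dV hdV dW hdW (p : HA L e dV hdV dW hdW))) * g ∈
        siegelParabolicPi (adelicGram (Fp L) e₁ (realDiagonal L (dD L e dV hdV dW hdW) (dD_conj L e dV hdV dW hdW)) (TW (Fp L) a')))
    {u : HA L e dV hdV dW hdW} (hu : u ∈ unipDelta L e dV hdV dW hdW)
    (ha : SiegelParabolicPi.aInvMat (g⁻¹ *
        toSp (Fp L) L (IsCMField.complexConj L) (n + n) 1 e₁ (Matrix.diagonal (dD L e dV hdV dW hdW)) (JW (Fp L) L a')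
          (complexConj_imagUnit L) (imagUnit_ne_zero L) (imagUnit_mul_self L)
          (realDiagonal_isSymm L (dD L e dV hdV dW hdW) (dD_conj L e dV hdV dW hdW)) (isSymm_TW (Fp L) a')
          (realDiagonal_map L (dD L e dV hdV dW hdW) (dD_conj L e dV hdV dW hdW)).symm (JW_eq (Fp L) L a')
          (UnitaryGroup.adelicInl (Fp L) L (IsCMField.complexConj L) (n + n) 1 (Matrix.diagonal (dD L e dV hdV dW hdW)) (JW (Fp L) L a')
            (toDiagA L e dV hdV dW hdW u)) * g) = 1)
    {S : Matrix (Fin n'') (Fin n'') (AdeleRing (𝓞 (Fp L)) (Fp L))}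
    (hS : (-⅟(2 : AdeleRing (𝓞 (Fp L)) (Fp L))) • SiegelParabolicPi.cMat (g⁻¹ *
        toSp (Fp L) L (IsCMField.complexConj L) (n + n) 1 e₁ (Matrix.diagonal (dD L e dV hdV dW hdW)) (JW (Fp L) L a')
          (complexConj_imagUnit L) (imagUnit_ne_zero L) (imagUnit_mul_self L)
          (realDiagonal_isSymm L (dD L e dV hdV dW hdW) (dD_conj L e dV hdV dW hdW)) (isSymm_TW (Fp L) a')
          (realDiagonal_map L (dD L e dV hdV dW hdW) (dD_conj L e dV hdV dW hdW)).symm (JW_eq (Fp L) L a')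
          (UnitaryGroup.adelicInl (Fp L) L (IsCMField.complexConj L) (n + n) 1 (Matrix.diagonal (dD L e dV hdV dW hdW)) (JW (Fp L) L a')
            (toDiagA L e dV hdV dW hdW u)) * g) = S)
    (hS0 : S.map (archHom (Fp L)) = 0) (Φinf : 𝓢((Fin n'' → mixedSpace (Fp L)), ℂ)) (φ : FinSB (Fp L) (Fin n'')) :
    (MpPsi.toOp (adelicSchrodinger (Fp L) (Fin n'')
        (adelicGram (Fp L) e₁ (realDiagonal L (dD L e dV hdV dW hdW) (dD_conj L e dV hdV dW hdW)) (TW (Fp L) a'))) q).symm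
        (pairRep (Fp L) L (IsCMField.complexConj L) (n + n) 1 e₁ (Matrix.diagonal (dD L e dV hdV dW hdW)) (JW (Fp L) L a')
          (chiSplittingLine L e₁ (dD L e dV hdV dW hdW) (dD_conj L e dV hdV dW hdW) (dD_ne_zero L e dV hdV dW hdW hdV0 hdW0)
            (toHeckeCharacter L lam) (isUnitary_toHeckeCharacter L lam)
            ((isOscillatorChar_toHeckeCharacter_iff lam).mpr hlam) (TW (Fp L) a')
            (isUnit_det_TW (Fp L) a') (JW (Fp L) L a') (JW_eq (Fp L) L a'))
          (toDiagA L e dV hdV dW hdW u, 1)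
          (MpPsi.toOp (adelicSchrodinger (Fp L) (Fin n'')
            (adelicGram (Fp L) e₁ (realDiagonal L (dD L e dV hdV dW hdW) (dD_conj L e dV hdV dW hdW)) (TW (Fp L) a'))) q
            (piSchwartzBruhatEquiv (Fp L) (Fin n'') (Φinf ⊗ₜ[ℂ] φ)))) =
      piSchwartzBruhatEquiv (Fp L) (Fin n'') (Φinf ⊗ₜ[ℂ]
        finMulLM (finSdChar (S.map (RingHom.snd (InfiniteAdeleRing (Fp L)) (FiniteAdeleRing (𝓞 (Fp L)) (Fp L)))))
          (isLocallyConstant_finSdChar _) φ) := by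
  -- the line splitting composed with `h ↦ (toDiagA h, 1)`, as a homomorphism on `H(𝔸)`
  let sl : HA L e dV hdV dW hdW →* adelicMpCont (Fp L) (Fin n'')
      (adelicGram (Fp L) e₁ (realDiagonal L (dD L e dV hdV dW hdW) (dD_conj L e dV hdV dW hdW)) (TW (Fp L) a')) :=
    (pairSplitting (Fp L) L (IsCMField.complexConj L) (n + n) 1 e₁ (Matrix.diagonal (dD L e dV hdV dW hdW)) (JW (Fp L) L a')
      (chiSplittingLine L e₁ (dD L e dV hdV dW hdW) (dD_conj L e dV hdV dW hdW) (dD_ne_zero L e dV hdV dW hdW hdV0 hdW0)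
        (toHeckeCharacter L lam) (isUnitary_toHeckeCharacter L lam)
        ((isOscillatorChar_toHeckeCharacter_iff lam).mpr hlam) (TW (Fp L) a')
        (isUnit_det_TW (Fp L) a') (JW (Fp L) L a') (JW_eq (Fp L) L a'))).comp
      ((toDiagA L e dV hdV dW hdW).toMonoidHom.prod 1)
  have hsl : ∀ h : HA L e dV hdV dW hdW, sl h =
      pairSplitting (Fp L) L (IsCMField.complexConj L) (n + n) 1 e₁ (Matrix.diagonal (dD L e dV hdV dW hdW)) (JW (Fp L) L a')
        (chiSplittingLine L e₁ (dD L e dV hdV dW hdW) (dD_conj L e dV hdV dW hdW) (dD_ne_zero L e dV hdV dW hdW hdV0 hdW0)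
          (toHeckeCharacter L lam) (isUnitary_toHeckeCharacter L lam)
          ((isOscillatorChar_toHeckeCharacter_iff lam).mpr hlam) (TW (Fp L) a')
          (isUnit_det_TW (Fp L) a') (JW (Fp L) L a') (JW_eq (Fp L) L a')) (toDiagA L e dV hdV dW hdW h, 1) := fun h => rfl
  -- its symplectic projection is `ι(toDiagA h ⊗ 1)`
  have hproj : ∀ h : HA L e dV hdV dW hdW,
      adelicMpCont.proj (Fp L) (Fin n'') (adelicGram (Fp L) e₁ (realDiagonal L (dD L e dV hdV dW hdW) (dD_conj L e dV hdV dW hdW)) (TW (Fp L) a')) (sl h) =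
        toSp (Fp L) L (IsCMField.complexConj L) (n + n) 1 e₁ (Matrix.diagonal (dD L e dV hdV dW hdW)) (JW (Fp L) L a')
          (complexConj_imagUnit L) (imagUnit_ne_zero L) (imagUnit_mul_self L)
          (realDiagonal_isSymm L (dD L e dV hdV dW hdW) (dD_conj L e dV hdV dW hdW)) (isSymm_TW (Fp L) a')
          (realDiagonal_map L (dD L e dV hdV dW hdW) (dD_conj L e dV hdV dW hdW)).symm (JW_eq (Fp L) L a')
          (UnitaryGroup.adelicInl (Fp L) L (IsCMField.complexConj L) (n + n) 1 (Matrix.diagonal (dD L e dV hdV dW hdW)) (JW (Fp L) L a')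
            (toDiagA L e dV hdV dW hdW h)) :=
    fun h => (congrArg _ (hsl h)).trans (proj_pairSplitting_line L e dV hdV dW hdW e₁ hdV0 hdW0 lam hlam a' (toDiagA L e dV hdV dW hdW h))
  have hj' : ∀ p : ↥(siegelDelta L e dV hdV dW hdW),
      g⁻¹ * ((adelicMpCont.proj (Fp L) (Fin n'') (adelicGram (Fp L) e₁ (realDiagonal L (dD L e dV hdV dW hdW) (dD_conj L e dV hdV dW hdW))
          (TW (Fp L) a'))).comp (sl.comp (siegelDelta L e dV hdV dW hdW).subtype)) p * g ∈
        siegelParabolicPi (adelicGram (Fp L) e₁ (realDiagonal L (dD L e dV hdV dW hdW) (dD_conj L e dV hdV dW hdW)) (TW (Fp L) a')) := by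
    intro p
    have h := hj p
    rw [← hproj] at h
    exact h
  have ha' : SiegelParabolicPi.aInvMat (g⁻¹ *
      adelicMpCont.proj (Fp L) (Fin n'') (adelicGram (Fp L) e₁ (realDiagonal L (dD L e dV hdV dW hdW) (dD_conj L e dV hdV dW hdW)) (TW (Fp L) a'))
        (sl u) * g) = 1 := by rw [hproj]; exact ha
  have hS' : (-⅟(2 : AdeleRing (𝓞 (Fp L)) (Fp L))) • SiegelParabolicPi.cMat (g⁻¹ *
      adelicMpCont.proj (Fp L) (Fin n'') (adelicGram (Fp L) e₁ (realDiagonal L (dD L e dV hdV dW hdW) (dD_conj L e dV hdV dW hdW)) (TW (Fp L) a'))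
        (sl u) * g) = S := by rw [hproj]; exact hS
  have key := kappaModel_tmul_of_mem_unipDelta L e dV hdV dW hdW hdV0 hdW0
    (isUnit_det_adelicGram (Fp L) e₁
      (isUnit_det_realDiagonal L (dD L e dV hdV dW hdW) (dD_conj L e dV hdV dW hdW) (dD_ne_zero L e dV hdV dW hdW hdV0 hdW0))
      (isUnit_det_TW (Fp L) a'))
    sl g q hqc hq hj' hu ha' hS' hS0 Φinf φ
  rw [hsl u] at key
  exact key

end Line

end Summit.HodgeConjecture.HodgeConjecture.Cruxes.HLiu418.K2LiuLinePairKappaModelOnUnipotents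

end
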